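import Summits.NavierStokesRegularity.NavierStokesRegularity.Theorems.SheetLawsMeridionalLedger
import Summits.NavierStokesRegularity.NavierStokesRegularity.Theorems.SheetLawsOddContrastEquation
import HarnessLib

/-!
# ROUND-21 (nsreg-p2, gen 23) — THE SHEET LAWS, Part 4/4: ADDENDUM 21B (Hou's number from Hou's fits)
# and KERNEL CERTIFICATE [A6] (the meridional-contrast law from the tree's Chen–Hou identity)

Landed for the planner seat nsreg-p2 (gen 23) by the prover seat nsreg-p4 (gen 14) as route-line
material of `SwirlThreshold` (`--supports stmt-NavierStokesRegularity-2002`): the text of the declarations is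
VERBATIM the planner's companion `HOME/ns-regularity-ideate-p2/R21-SheetLaws.lean` (v8, sha16
e3c548b310767775), split into files of ≤ 400 lines (this file: §§8–9 — `budget_of_asymptotic_selfsimilar`, `hou_number_ge_half`; `meridionalContrast_eq_smul`, `meridionalContrast_transport_euler`, `omegaTilde_transport_ns`, `meridionalContrast_transport_ns`).

WHAT THIS IS NOT: arithmetic consequences of fitted power laws taken as HYPOTHESES, and identities for
classical solutions; not a claim about Hou's computation, no regularity claim.
-/

namespace Summit.NavierStokesRegularity.NavierStokesRegularity.Theorems.SheetLaws

open MeasureTheory Set Filter Topology Metric WithLp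
open scoped ENNReal NNReal
open Literature.Analysis Literature.Analysis.FluidPDE

/-! ## 8. ADDENDUM 21B — Hou's number from Hou's fits (memo §9)

Hou 2022 (arXiv:2107.06509) is in the odd class (`u₁` odd in `z`, p.6) and reports the fits
`‖u₁‖_∞ ∼ (T-t)⁻¹`, `Z(t) ∼ (T-t)^{1/2}`, `R(t) = O((T-t)^{1/2})` (p.4, p.11); hence
`sup|χ| ≥ R²u₁(R,Z)/Z ≥ a(T-t)^{-1/2}`.  The two lemmas below turn S-21.1 plus these fitted
power laws (taken as hypotheses) into the prediction `(T-t)·sup_x(-u_z/z) ≥ ½` on log-average: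
the tail must compress at least half as fast as the ring stretches (`2ψ_{1,z}(R,Z) = 1/(T-t)`). -/

section Addendum21B

/-- **Addendum 21B (Hou's number from Hou's fits), the arithmetic.**  If the odd contrast obeys
the max-principle bound `M(t) ≤ M(s)·exp B` (`B` = compression budget on `[s,t]`), and the
data give `M(t) ≥ a·(T-t)^{-1/2}` (late) and `M(s) ≤ b·(T-s)^{-1/2}` (early), then
`½·ln((T-s)/(T-t)) + ln(a/b) ≤ B`: the budget must diverge like `½|ln(T-t)|`. -/
theorem budget_of_asymptotic_selfsimilar {a b τs τt B Ms Mt : ℝ} (ha : 0 < a) (hb : 0 < b)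
    (hτs : 0 < τs) (hτt : 0 < τt)
    (hlate : a * τt ^ (-(1 / 2 : ℝ)) ≤ Mt) (hearly : Ms ≤ b * τs ^ (-(1 / 2 : ℝ)))
    (hmax : Mt ≤ Ms * Real.exp B) :
    (1 / 2) * Real.log (τs / τt) + Real.log (a / b) ≤ B := by
  have hE : 0 < Real.exp B := Real.exp_pos B
  have h1 : a * τt ^ (-(1 / 2 : ℝ)) ≤ b * τs ^ (-(1 / 2 : ℝ)) * Real.exp B :=
    hlate.trans (hmax.trans (by gcongr))
  have hl : 0 < a * τt ^ (-(1 / 2 : ℝ)) := by positivity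
  have h2 := Real.log_le_log hl h1
  rw [Real.log_mul ha.ne' (by positivity), Real.log_mul (by positivity) hE.ne',
    Real.log_mul hb.ne' (by positivity), Real.log_rpow hτt, Real.log_rpow hτs,
    Real.log_exp] at h2
  rw [Real.log_div hτs.ne' hτt.ne', Real.log_div ha.ne' hb.ne']
  linarith

/-- **Hou's number, normalised form.**  With the ring stretching rate `2ψ_{1,z}(R,Z,t) = 1/(T-t)`
(Hou's fit `‖u₁‖_∞ = A/(T-t)` + alignment), a uniform bound `(T-τ)·sup_x(-u_z/z)(τ) ≤ c` on
`[s,t]` caps the budget by `c·ln((T-s)/(T-t))`; combined with the previous lemma,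
`c ≥ ½ + ln(a/b)/ln((T-s)/(T-t))` — i.e. `c ≥ ½` asymptotically: the tail must compress at
least half as fast as the ring stretches. -/
theorem hou_number_ge_half {a b τs τt c Ms Mt : ℝ} (ha : 0 < a) (hb : 0 < b)
    (hτs : 0 < τs) (hτt : 0 < τt) (hst : τt < τs)
    (hlate : a * τt ^ (-(1 / 2 : ℝ)) ≤ Mt) (hearly : Ms ≤ b * τs ^ (-(1 / 2 : ℝ)))
    (hmax : Mt ≤ Ms * Real.exp (c * Real.log (τs / τt))) :
    1 / 2 + Real.log (a / b) / Real.log (τs / τt) ≤ c := by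
  have hL : 0 < Real.log (τs / τt) := Real.log_pos (by rw [lt_div_iff₀ hτt]; linarith)
  have h := budget_of_asymptotic_selfsimilar ha hb hτs hτt hlate hearly hmax
  rw [← sub_nonneg] at h ⊢
  have : c - (1 / 2 + Real.log (a / b) / Real.log (τs / τt))
      = (c * Real.log (τs / τt) - ((1 / 2) * Real.log (τs / τt) + Real.log (a / b)))
        / Real.log (τs / τt) := by
    field_simp
  rw [this]
  positivity


end Addendum21B

/-! ## 9. KERNEL CERTIFICATE of [A6]: the meridional-contrast law, derived from the tree's
Chen–Hou equation / swirl-of-vorticity transport (`AxisymmetricVorticityTransport`)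

`ζ = ω_θ/(rz) = Ω/(r²z)` (`meridionalContrast`).  Inviscid part EXACT
(`meridionalContrast_transport_euler`: `∂ₜζ + (u·∇)ζ = (-u_z/z)ζ + 2χ∂_zΓ/r⁴` from
`IsClassicalNSSolutionOn.chenHou_omegaTilde_transport`); Navier–Stokes version with the viscous
term in the tree's pairing form `ν⟪Jx, Δω⟫/(r²z)` (`omegaTilde_transport_ns`,
`meridionalContrast_transport_ns`; its cylindrical form `ν(∂ᵣ²+3r⁻¹∂ᵣ+∂_z²+2z⁻¹∂_z)ζ` is the
sympy-certified part of [A6], kit j285851).  The potential is the SAME `-u_z/z` as for `χ`. -/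

section KernelCertificateA6

open scoped Laplacian InnerProductSpace RealInnerProductSpace ContDiff

/-- The meridional contrast is `(1/z) · ω̃`, `ω̃ = Ω/r²` (Chen–Hou's variable). -/
theorem meridionalContrast_eq_smul (v : EuclideanSpace ℝ (Fin 3) → EuclideanSpace ℝ (Fin 3)) :
    meridionalContrast v =
      fun y => (y 2)⁻¹ • (swirl (curl v) y * (cylRadius y ^ 2)⁻¹) := by
  funext y
  simp only [meridionalContrast, smul_eq_mul, cylRadius_sq]
  rw [div_eq_mul_inv, mul_inv]
  ring

/-- **[A6]₀ The meridional-contrast law, inviscid part (kernel certificate).**  For an unforced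
classical Euler solution with axisymmetric velocity, off the axis and off the sheet,
`∂ₜζ + (u·∇)ζ = (-u_z/z)·ζ + 2χ ∂_zΓ / r⁴` with `ζ = ω_θ/(rz)`, `χ = Γ/z`: the SAME compression
potential as the odd contrast, plus the swirl feed.  Derived from the tree's Chen–Hou equation
`IsClassicalNSSolutionOn.chenHou_omegaTilde_transport` (`∂ₜω̃ + (u·∇)ω̃ = r⁻⁴∂_z(Γ²)`). -/
theorem meridionalContrast_transport_euler {S : Set ℝ}
    {u : ℝ → EuclideanSpace ℝ (Fin 3) → EuclideanSpace ℝ (Fin 3)}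
    {p : ℝ → EuclideanSpace ℝ (Fin 3) → ℝ}
    (h : IsClassicalEulerSolutionOn S 0 u p) (hS : UniqueDiffOn ℝ S)
    (hcl : S ⊆ closure (interior S)) (hu : ∀ t ∈ S, IsAxisymmetric (u t)) {t : ℝ} (ht : t ∈ S)
    {x : EuclideanSpace ℝ (Fin 3)} (hx : cylRadius x ≠ 0) (hz : x 2 ≠ 0) :
    timeDerivWithin S (fun s => meridionalContrast (u s)) t x
        + convect (u t) (meridionalContrast (u t)) x =
      sheetCompression (u t) x * meridionalContrast (u t) x + swirlFeed (u t) x := by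
  -- Chen–Hou's `ω̃`-equation at `(t, x)`
  have hΩ := h.chenHou_omegaTilde_transport hS hcl hu ht hx
  -- regularity
  have hU1 : DifferentiableAt ℝ (u t) x :=
    ((h.contDiff_velocity ht).differentiable (by simp)) x
  have hω : IsSmoothSpaceTimeOn S (vorticity u) :=
    h.smooth_velocity.isSmoothSpaceTimeOn_vorticity hS
  have hωd : DifferentiableAt ℝ (vorticity u t) x :=
    ((hω.contDiff_slice ht).differentiable (by simp)) x
  have hΩd : DifferentiableAt ℝ (swirl (vorticity u t)) x := differentiableAt_swirl hωd
  have hr := hasFDerivAt_inv_cylRadius_sq hx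
  have hOmd : DifferentiableAt ℝ (fun y => swirl (vorticity u t) y * (cylRadius y ^ 2)⁻¹) x :=
    hΩd.mul hr.differentiableAt
  have hfd := hasFDerivAt_invHeight hz
  -- rewrite `ζ` through `ω̃` (note `vorticity u s = curl (u s)`)
  have hζ : ∀ s, meridionalContrast (u s) =
      fun y => (y 2)⁻¹ • (swirl (vorticity u s) y * (cylRadius y ^ 2)⁻¹) := by
    intro s; rw [meridionalContrast_eq_smul, vorticity_apply]
  -- (1) time derivative
  have h1 : timeDerivWithin S (fun s => meridionalContrast (u s)) t x =
      (x 2)⁻¹ * timeDerivWithin S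
        (fun s y => swirl (vorticity u s) y * (cylRadius y ^ 2)⁻¹) t x := by
    simp only [hζ, timeDerivWithin_apply, smul_eq_mul]
    have hd : DifferentiableWithinAt ℝ
        (fun s => swirl (vorticity u s) x * (cylRadius x ^ 2)⁻¹) S t := by
      refine DifferentiableWithinAt.mul_const ?_ _
      simp only [swirl_eq_inner_rotGen]
      exact (differentiableWithinAt_const (rotGen x)).inner ℝ (hω.differentiableWithinAt_time ht x)
    have := derivWithin_clm_comp_apply ((x 2)⁻¹ • ContinuousLinearMap.id ℝ ℝ) hd
    simpa using this
  -- (2) spatial derivative along `u t x`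
  have h2 : fderiv ℝ (meridionalContrast (u t)) x (u t x) =
      (x 2)⁻¹ * fderiv ℝ (fun y => swirl (vorticity u t) y * (cylRadius y ^ 2)⁻¹) x (u t x)
        + (-((x 2) ^ 2)⁻¹ * u t x 2) * (swirl (vorticity u t) x * (cylRadius x ^ 2)⁻¹) := by
    rw [hζ, fderiv_fun_smul hfd.differentiableAt hOmd]
    simp only [_root_.add_apply, _root_.smul_apply,
      ContinuousLinearMap.smulRight_apply, smul_eq_mul, fderiv_invHeight hz]
  -- (3) the source `∂_z(Γ²) = 2 Γ ∂_zΓ`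
  have hsrc : partialDeriv eZ (fun y => swirl (u t) y ^ 2) x =
      2 * swirl (u t) x * fderiv ℝ (swirl (u t)) x (EuclideanSpace.single 2 1) := by
    rw [partialDeriv_apply,
      show (fun y => swirl (u t) y ^ 2) = fun y => swirl (u t) y * swirl (u t) y from
        funext fun y => sq _,
      fderiv_fun_mul (differentiableAt_swirl hU1) (differentiableAt_swirl hU1)]
    simp only [_root_.add_apply, _root_.smul_apply, smul_eq_mul, eZ]
    ring
  -- assemble
  simp only [convect_apply] at hΩ ⊢
  rw [h1, h2]
  have hD : timeDerivWithin S (fun s y => swirl (vorticity u s) y * (cylRadius y ^ 2)⁻¹) t x =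
      (cylRadius x ^ 4)⁻¹ * partialDeriv eZ (fun y => swirl (u t) y ^ 2) x
        - fderiv ℝ (fun y => swirl (vorticity u t) y * (cylRadius y ^ 2)⁻¹) x (u t x) := by
    linarith [hΩ]
  rw [hD, hsrc, show cylRadius x ^ 4 = (cylRadius x ^ 2) ^ 2 by ring]
  simp only [sheetCompression, meridionalContrast, swirlFeed, oddContrast, vorticity_apply,
    cylRadius_sq]
  have hr2 : x 0 ^ 2 + x 1 ^ 2 ≠ 0 := by rw [← cylRadius_sq]; exact pow_ne_zero 2 hx
  field_simp
  ring


/-- **The Navier–Stokes `ω̃`-equation off the axis** (`ω̃ = Ω/r² = ω_θ/r`): Chen–Hou's inviscid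
identity plus the viscous term in the tree's form `ν ⟪Jx, Δω⟫/r²` (the classical cylindrical form
`ν(Δ + (2/r)∂ᵣ)ω̃` of that term is not expanded here).  Same proof as the tree's
`chenHou_omegaTilde_transport`, carrying the viscous term of `swirl_vorticity_transport`. -/
theorem omegaTilde_transport_ns {S : Set ℝ} {ν : ℝ}
    {u : ℝ → EuclideanSpace ℝ (Fin 3) → EuclideanSpace ℝ (Fin 3)}
    {p : ℝ → EuclideanSpace ℝ (Fin 3) → ℝ}
    (h : IsClassicalNSSolutionOn S ν 0 u p) (hS : UniqueDiffOn ℝ S)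
    (hcl : S ⊆ closure (interior S)) (hu : ∀ t ∈ S, IsAxisymmetric (u t)) {t : ℝ} (ht : t ∈ S)
    {x : EuclideanSpace ℝ (Fin 3)} (hx : cylRadius x ≠ 0) :
    timeDerivWithin S (fun s y => swirl (vorticity u s) y * (cylRadius y ^ 2)⁻¹) t x +
        convect (u t) (fun y => swirl (vorticity u t) y * (cylRadius y ^ 2)⁻¹) x =
      (cylRadius x ^ 4)⁻¹ * partialDeriv eZ (fun y => swirl (u t) y ^ 2) x
        + ν * ⟪rotGen x, (Δ (vorticity u t)) x⟫ * (cylRadius x ^ 2)⁻¹ := by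
  have hU1 : DifferentiableAt ℝ (u t) x :=
    ((h.contDiff_velocity ht).differentiable (by simp)) x
  have hω : IsSmoothSpaceTimeOn S (vorticity u) := h.smooth_velocity.isSmoothSpaceTimeOn_vorticity hS
  have hωd : DifferentiableAt ℝ (vorticity u t) x :=
    ((hω.contDiff_slice ht).differentiable (by simp)) x
  -- the `Ω`-equation (with viscosity, zero force)
  have hΩ := h.swirl_vorticity_transport hS hcl (fun _ _ y => curl_zero y) hu ht x
  -- time derivative: the factor `r⁻²` does not depend on time
  have ht2 : timeDerivWithin S (fun s y => swirl (vorticity u s) y * (cylRadius y ^ 2)⁻¹) t x =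
      timeDerivWithin S (fun s => swirl (vorticity u s)) t x * (cylRadius x ^ 2)⁻¹ := by
    rw [timeDerivWithin_apply, timeDerivWithin_apply, derivWithin_mul_const]
    simp only [swirl_eq_inner_rotGen]
    exact (differentiableWithinAt_const _).inner ℝ (hω.differentiableWithinAt_time ht x)
  -- convective derivative: product rule
  have hΩd : DifferentiableAt ℝ (swirl (vorticity u t)) x := differentiableAt_swirl hωd
  have hr := hasFDerivAt_inv_cylRadius_sq hx
  have hc2 : convect (u t) (fun y => swirl (vorticity u t) y * (cylRadius y ^ 2)⁻¹) x =
      convect (u t) (swirl (vorticity u t)) x * (cylRadius x ^ 2)⁻¹ +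
        swirl (vorticity u t) x * (-((cylRadius x ^ 2) ^ 2)⁻¹ *
          (2 * x 0 * u t x 0 + 2 * x 1 * u t x 1)) := by
    rw [convect_apply, convect_apply, fderiv_fun_mul hΩd hr.differentiableAt, hr.fderiv]
    simp only [_root_.add_apply, _root_.smul_apply, smul_eq_mul, PiLp.proj_apply]
    ring
  -- the source term
  have hsrc : partialDeriv eZ (fun y => swirl (u t) y ^ 2) x =
      2 * swirl (u t) x * ⟪rotGen x, fderiv ℝ (u t) x (EuclideanSpace.single 2 1)⟫ := by
    rw [partialDeriv_apply,
      show (fun y => swirl (u t) y ^ 2) = fun y => swirl (u t) y * swirl (u t) y from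
        funext fun y => sq _,
      fderiv_fun_mul (differentiableAt_swirl hU1) (differentiableAt_swirl hU1)]
    simp only [_root_.add_apply, _root_.smul_apply, smul_eq_mul]
    rw [fderiv_swirl_apply hU1, eZ, rotGen_single_two, inner_zero_left, add_zero]
    ring
  -- the algebra: Lagrange's identity and `⟪x_h, ω⟫ = −⟪Jx, Du e_z⟫`
  have hhor : ⟪(toLp 2 ![x 0, x 1, 0] : EuclideanSpace ℝ (Fin 3)), vorticity u t x⟫ =
      -⟪rotGen x, fderiv ℝ (u t) x (EuclideanSpace.single 2 1)⟫ := by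
    rw [real_inner_comm, vorticity_apply]
    exact (hu t ht).inner_curl_horizontal hU1
  have hxu : ⟪(toLp 2 ![x 0, x 1, 0] : EuclideanSpace ℝ (Fin 3)), u t x⟫ =
      x 0 * u t x 0 + x 1 * u t x 1 := by
    simp only [PiLp.inner_apply, RCLike.inner_apply, conj_trivial, Fin.sum_univ_three,
      Matrix.cons_val_zero, Matrix.cons_val_one, Matrix.cons_val_two, Matrix.head_cons,
      Matrix.tail_cons]
    ring
  have hΓ : swirl (u t) x = ⟪rotGen x, u t x⟫ := by rw [swirl_eq_inner_rotGen]
  have hΩ' : swirl (vorticity u t) x = ⟪rotGen x, vorticity u t x⟫ := by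
    rw [swirl_eq_inner_rotGen]
  have hlag := cylRadius_sq_mul_inner_rotGen x (u t x) (vorticity u t x)
  rw [hxu, hhor, ← hΩ', ← hΓ] at hlag
  have hq : (cylRadius x ^ 2)⁻¹ * cylRadius x ^ 2 = 1 := inv_mul_cancel₀ (pow_ne_zero 2 hx)
  have hr4 : (cylRadius x ^ 4)⁻¹ = (cylRadius x ^ 2)⁻¹ ^ 2 := by
    rw [← inv_pow]; ring
  rw [ht2, hc2, hsrc, eq_sub_of_add_eq hΩ, hr4]
  linear_combination 2 * (cylRadius x ^ 2)⁻¹ ^ 2 * hlag -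
    2 * ⟪rotGen (u t x), vorticity u t x⟫ * (cylRadius x ^ 2)⁻¹ * hq

/-- **[A6] The meridional-contrast law for Navier–Stokes (kernel certificate, viscous term in the
tree's pairing form).**  Off the axis and the sheet:
`∂ₜζ + (u·∇)ζ = (-u_z/z)·ζ + 2χ∂_zΓ/r⁴ + ν ⟪Jx, Δω⟫/(r² z)`.  The classical cylindrical form of
the last term is `ν(∂ᵣ² + 3r⁻¹∂ᵣ + ∂_z² + 2z⁻¹∂_z)ζ` (memo [A6]; sympy-certified, not expanded
here). -/
theorem meridionalContrast_transport_ns {S : Set ℝ} {ν : ℝ}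
    {u : ℝ → EuclideanSpace ℝ (Fin 3) → EuclideanSpace ℝ (Fin 3)}
    {p : ℝ → EuclideanSpace ℝ (Fin 3) → ℝ}
    (h : IsClassicalNSSolutionOn S ν 0 u p) (hS : UniqueDiffOn ℝ S)
    (hcl : S ⊆ closure (interior S)) (hu : ∀ t ∈ S, IsAxisymmetric (u t)) {t : ℝ} (ht : t ∈ S)
    {x : EuclideanSpace ℝ (Fin 3)} (hx : cylRadius x ≠ 0) (hz : x 2 ≠ 0) :
    timeDerivWithin S (fun s => meridionalContrast (u s)) t x
        + convect (u t) (meridionalContrast (u t)) x =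
      sheetCompression (u t) x * meridionalContrast (u t) x + swirlFeed (u t) x
        + ν * (⟪rotGen x, (Δ (vorticity u t)) x⟫ / ((x 0 ^ 2 + x 1 ^ 2) * x 2)) := by
  have hΩ := omegaTilde_transport_ns h hS hcl hu ht hx
  have hU1 : DifferentiableAt ℝ (u t) x :=
    ((h.contDiff_velocity ht).differentiable (by simp)) x
  have hω : IsSmoothSpaceTimeOn S (vorticity u) :=
    h.smooth_velocity.isSmoothSpaceTimeOn_vorticity hS
  have hωd : DifferentiableAt ℝ (vorticity u t) x :=
    ((hω.contDiff_slice ht).differentiable (by simp)) x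
  have hΩd : DifferentiableAt ℝ (swirl (vorticity u t)) x := differentiableAt_swirl hωd
  have hr := hasFDerivAt_inv_cylRadius_sq hx
  have hOmd : DifferentiableAt ℝ (fun y => swirl (vorticity u t) y * (cylRadius y ^ 2)⁻¹) x :=
    hΩd.mul hr.differentiableAt
  have hfd := hasFDerivAt_invHeight hz
  have hζ : ∀ s, meridionalContrast (u s) =
      fun y => (y 2)⁻¹ • (swirl (vorticity u s) y * (cylRadius y ^ 2)⁻¹) := by
    intro s; rw [meridionalContrast_eq_smul, vorticity_apply]
  have h1 : timeDerivWithin S (fun s => meridionalContrast (u s)) t x =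
      (x 2)⁻¹ * timeDerivWithin S
        (fun s y => swirl (vorticity u s) y * (cylRadius y ^ 2)⁻¹) t x := by
    simp only [hζ, timeDerivWithin_apply, smul_eq_mul]
    have hd : DifferentiableWithinAt ℝ
        (fun s => swirl (vorticity u s) x * (cylRadius x ^ 2)⁻¹) S t := by
      refine DifferentiableWithinAt.mul_const ?_ _
      simp only [swirl_eq_inner_rotGen]
      exact (differentiableWithinAt_const (rotGen x)).inner ℝ (hω.differentiableWithinAt_time ht x)
    have := derivWithin_clm_comp_apply ((x 2)⁻¹ • ContinuousLinearMap.id ℝ ℝ) hd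
    simpa using this
  have h2 : fderiv ℝ (meridionalContrast (u t)) x (u t x) =
      (x 2)⁻¹ * fderiv ℝ (fun y => swirl (vorticity u t) y * (cylRadius y ^ 2)⁻¹) x (u t x)
        + (-((x 2) ^ 2)⁻¹ * u t x 2) * (swirl (vorticity u t) x * (cylRadius x ^ 2)⁻¹) := by
    rw [hζ, fderiv_fun_smul hfd.differentiableAt hOmd]
    simp only [_root_.add_apply, _root_.smul_apply,
      ContinuousLinearMap.smulRight_apply, smul_eq_mul, fderiv_invHeight hz]
  have hsrc : partialDeriv eZ (fun y => swirl (u t) y ^ 2) x =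
      2 * swirl (u t) x * fderiv ℝ (swirl (u t)) x (EuclideanSpace.single 2 1) := by
    rw [partialDeriv_apply,
      show (fun y => swirl (u t) y ^ 2) = fun y => swirl (u t) y * swirl (u t) y from
        funext fun y => sq _,
      fderiv_fun_mul (differentiableAt_swirl hU1) (differentiableAt_swirl hU1)]
    simp only [_root_.add_apply, _root_.smul_apply, smul_eq_mul, eZ]
    ring
  simp only [convect_apply] at hΩ ⊢
  rw [h1, h2]
  have hD : timeDerivWithin S (fun s y => swirl (vorticity u s) y * (cylRadius y ^ 2)⁻¹) t x =
      (cylRadius x ^ 4)⁻¹ * partialDeriv eZ (fun y => swirl (u t) y ^ 2) x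
        + ν * ⟪rotGen x, (Δ (vorticity u t)) x⟫ * (cylRadius x ^ 2)⁻¹
        - fderiv ℝ (fun y => swirl (vorticity u t) y * (cylRadius y ^ 2)⁻¹) x (u t x) := by
    linarith [hΩ]
  rw [hD, hsrc, show cylRadius x ^ 4 = (cylRadius x ^ 2) ^ 2 by ring]
  simp only [sheetCompression, meridionalContrast, swirlFeed, oddContrast, vorticity_apply,
    cylRadius_sq]
  have hr2 : x 0 ^ 2 + x 1 ^ 2 ≠ 0 := by rw [← cylRadius_sq]; exact pow_ne_zero 2 hx
  field_simp
  ring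


end KernelCertificateA6

end Summit.NavierStokesRegularity.NavierStokesRegularity.Theorems.SheetLaws
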